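import Literature.AnabelianGeometry.SemiGraphs.PSCCoveringDatumRamificationProofs
import Literature.AnabelianGeometry.SemiGraphs.PSCGraphicitySub2
import Mathlib.Tactic.Group
import HarnessLib

/-!
# Vertex stabilizers of `G_U` are the normalizers of the vertex kernels of [IUTchI] Rmk. 1.2.3 (iv)

Mochizuki, *Inter-universal Teichmüller theory I*, Remark 1.2.3 (iv), kurims manuscript p. 42: "in order
to characterize the unramified verticial subgroups of `Π^unr_G`, it suffices — by considering
stabilizers of vertices of underlying semi-graphs of finite étale `Π^unr_G`-coverings of `G` — to give
a functorial characterization of the set of vertices of `G` [i.e., a characterization which may also be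
applied to finite étale `Π^unr_G`-coverings of `G`]. … the set of vertices of `G` may be characterized
as the set of [nontrivial!] quotients `M^unr-vert_G ↠ M^unr_G[v] ⊗ F_l`."  This proof-only file
(abc-iut cell, row CombGC:Thm1.6(iii)/T16-L16, GAP-LEDGER G-w5d174-1) supplies the step "by
considering stabilizers" over abc-iut-L3-t4's covering datum `D = G.restrict U hU` (`U` an open
normal subgroup containing `Ker(Π_G ↠ Π^unr_G)`): the Galois group `Π_G/U` acts on the vertices
`w = (v, U y Π_v)` of `G_U` (`g · w = (v, U g y Π_v)`), and — FUNCTORIALITY of the characterization —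
conjugation by `g ∈ Π_G` carries the inverse image `K_w ⊆ U ⊆ Π_G` of the kernel of
`M^unr-vert_{G_U} ↠ M^unr_{G_U}[w] ⊗ F_l` (abc-iut-w4-d052's `vertexQuotientKer` of the datum `G_U`)
to `K_{g·w}` (`conj_map_vertexQuotientKer_restrict`).  Consequently, granted the injectivity
`w ↦ K_w` ([IUTchI] Rmk. 1.2.3 (iv) "[nontrivial!] quotients", abc-iut-w4-d052's typed
`VertexSetCharacterization` APPLIED TO `G_U`), the stabilizer `U · Π_v^{y}` of the vertex `w` in
`Π_G` is the NORMALIZER of `K_w` (`normalizer_map_vertexQuotientKer_restrict`).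

Also: the images in `Π_G` of the datum's `E^unr_{G_U}`, `M^unr_{G_U}[w]`, `K_w`
(`map_subtype_unrAbKer_restrict`, `map_subtype_unrVertAbOf_restrict`,
`map_subtype_vertexQuotientKer_restrict`).  Pure group theory over the interface; 0 defs; nothing
here takes a side on [IUTchIII] Cor. 3.12. [cite: Mochizuki2012, IUTchI Rmk 1.2.3(iv) p.42]
-/

noncomputable section

namespace Literature.AnabelianGeometry.SemiGraphs

namespace PSCDatum

open scoped Pointwise
open PSCCovering

universe u

variable {P : Type u} [Group P] [TopologicalSpace P] [IsTopologicalGroup P] (G : PSCDatum P)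
  (U : Subgroup P) [U.FiniteIndex] (hU : IsOpen (U : Set P))

/-! ### 1. Conjugation calculus in `Π_G` -/

section Conj

variable {G U}

omit [TopologicalSpace P] [IsTopologicalGroup P] [U.FiniteIndex] in
/-- Conjugation commutes with `⨆`. [folklore] -/
private theorem conj_iSup {ι : Sort*} (γ : ConjAct P) (S : ι → Subgroup P) :
    γ • (⨆ i, S i) = ⨆ i, γ • S i := by
  simp only [Subgroup.pointwise_smul_def, Subgroup.map_iSup]

omit [U.FiniteIndex] in
/-- Conjugation commutes with topological closure. [folklore] -/
private theorem conj_topologicalClosure (g : P) (S : Subgroup P) :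
    ConjAct.toConjAct g • S.topologicalClosure = (ConjAct.toConjAct g • S).topologicalClosure := by
  apply SetLike.coe_injective
  rw [Subgroup.coe_pointwise_smul, Subgroup.topologicalClosure_coe, Subgroup.topologicalClosure_coe,
    Subgroup.coe_pointwise_smul]
  have h : (fun x : P => ConjAct.toConjAct g • x) = fun x => g * x * g⁻¹ := by
    ext x; rw [ConjAct.smul_def, ConjAct.ofConjAct_toConjAct]
  have hh : IsHomeomorph (fun x : P => g * x * g⁻¹) :=
    (Homeomorph.mulRight g⁻¹).isHomeomorph.comp (Homeomorph.mulLeft g).isHomeomorph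
  rw [← Set.image_smul, ← Set.image_smul, h]
  exact (hh.homeomorph (fun x : P => g * x * g⁻¹)).image_closure (S : Set P)

omit [TopologicalSpace P] [IsTopologicalGroup P] [U.FiniteIndex] in
/-- Conjugation commutes with "the subgroup generated by the `l`-th powers". [folklore] -/
private theorem conj_closure_pow_image (γ : ConjAct P) (S : Subgroup P) (l : ℕ) :
    γ • Subgroup.closure ((fun x : P => x ^ l) '' (S : Set P)) =
      Subgroup.closure ((fun x : P => x ^ l) '' ((γ • S : Subgroup P) : Set P)) := by
  rw [Subgroup.smul_closure]
  congr 1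
  ext x
  simp only [Set.mem_smul_set, Set.mem_image, SetLike.mem_coe, Subgroup.mem_pointwise_smul_iff_inv_smul_mem]
  constructor
  · rintro ⟨_, ⟨s, hs, rfl⟩, rfl⟩
    exact ⟨γ • s, by rwa [inv_smul_smul], (smul_pow' γ s l).symm⟩
  · rintro ⟨t, ht, rfl⟩
    exact ⟨(γ⁻¹ • t) ^ l, ⟨γ⁻¹ • t, ht, rfl⟩, by rw [← smul_pow', smul_inv_smul]⟩

omit [TopologicalSpace P] [IsTopologicalGroup P] [U.FiniteIndex] in
/-- For `u ∈ U`, `A ⊆ U` and `N ⊇ [U, U]`: `u A u⁻¹ · N = A · N` (in `U^{ab}` conjugation by `U` is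
trivial). [folklore] -/
private theorem conj_sup_eq_of_commutator_le {A N : Subgroup P} {u : P} (hu : u ∈ U) (hA : A ≤ U)
    (hN : ⁅U, U⁆ ≤ N) : ConjAct.toConjAct u • A ⊔ N = A ⊔ N := by
  have key : ∀ (u : P), u ∈ U → ∀ (A : Subgroup P), A ≤ U → ConjAct.toConjAct u • A ⊔ N ≤ A ⊔ N := by
    intro u hu A hA
    refine sup_le ?_ le_sup_right
    intro x hx
    rw [Subgroup.mem_pointwise_smul_iff_inv_smul_mem, ← ConjAct.toConjAct_inv, ConjAct.smul_def,
      ConjAct.ofConjAct_toConjAct, inv_inv] at hx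
    -- `x = [u, u⁻¹ x u] · (u⁻¹ x u)`
    have hc : u * (u⁻¹ * x * u) * u⁻¹ * (u⁻¹ * x * u)⁻¹ ∈ N :=
      hN (Subgroup.commutator_mem_commutator hu (hA hx))
    have : x = u * (u⁻¹ * x * u) * u⁻¹ * (u⁻¹ * x * u)⁻¹ * (u⁻¹ * x * u) := by group
    rw [this]
    exact Subgroup.mul_mem _ (Subgroup.mem_sup_right hc) (Subgroup.mem_sup_left hx)
  refine le_antisymm (key u hu A hA) ?_
  have hA' : ConjAct.toConjAct u • A ≤ U := by
    intro x hx
    rw [Subgroup.mem_pointwise_smul_iff_inv_smul_mem, ← ConjAct.toConjAct_inv, ConjAct.smul_def,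
      ConjAct.ofConjAct_toConjAct, inv_inv] at hx
    have := U.mul_mem (U.mul_mem hu (hA hx)) (U.inv_mem hu)
    rwa [show u * (u⁻¹ * x * u) * u⁻¹ = x by group] at this
  have h2 := key u⁻¹ (U.inv_mem hu) _ hA'
  rwa [← mul_smul, ← map_mul, inv_mul_cancel, map_one, one_smul] at h2

end Conj

/-! ### 2. The images in `Π_G` of `E^unr_{G_U}`, `M^unr_{G_U}[w]`, `K_w` -/

section Images

/-- `E^unr_{G_U}` in `Π_G`: the image of the datum's `unrAbKer` is `closure([U,U] · Ker(Π_G ↠ Π^unr_G))`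
(for `U ⊇ Ker`). [cite: Mochizuki2012, IUTchI Rmk 1.2.3(iv) p.42] -/
theorem map_subtype_unrAbKer_restrict (hKU : G.unrKer ≤ U) :
    ((G.restrict U hU).unrAbKer).map U.subtype = (⁅U, U⁆ ⊔ G.unrKer).topologicalClosure := by
  unfold unrAbKer
  rw [map_subtype_topologicalClosure_of_isOpen hU, Subgroup.map_sup, Subgroup.map_commutator,
    ← MonoidHom.range_eq_map, Subgroup.range_subtype, G.map_subtype_unrKer_restrict U hU hKU]

/-- `M^unr_{G_U}[w]` in `Π_G`: the image of the datum's `unrVertAbOf w` at the vertex `w = U y Π_v` is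
`closure((U ∩ y Π_v y⁻¹) · E^unr_{G_U})`. [cite: Mochizuki2012, IUTchI Rmk 1.2.3(iv) p.42] -/
theorem map_subtype_unrVertAbOf_restrict (hKU : G.unrKer ≤ U) (v : G.graph.V)
    (j : dcFin U (G.vertGp v)) :
    ((G.restrict U hU).unrVertAbOf ⟨v, j⟩).map U.subtype =
      ((U ⊓ ConjAct.toConjAct (G.vrep U ⟨v, j⟩) • G.vertGp v) ⊔
        (⁅U, U⁆ ⊔ G.unrKer).topologicalClosure).topologicalClosure := by
  unfold unrVertAbOf
  rw [map_subtype_topologicalClosure_of_isOpen hU, Subgroup.map_sup, restrict_vertGp_map,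
    G.map_subtype_unrAbKer_restrict U hU hKU]

/-- `K_w` in `Π_G`: the image of the datum's `vertexQuotientKer l w` (the inverse image of the kernel of
`M^unr-vert_{G_U} ↠ M^unr_{G_U}[w] ⊗ F_l`). [cite: Mochizuki2012, IUTchI Rmk 1.2.3(iv) p.42] -/
theorem map_subtype_vertexQuotientKer_restrict (hKU : G.unrKer ≤ U) (l : ℕ)
    (w : (G.restrictGraph U).V) :
    ((G.restrict U hU).vertexQuotientKer l w).map U.subtype =
      ((⁅U, U⁆ ⊔ G.unrKer).topologicalClosure ⊔
        (⨆ w' : {w' : (G.restrictGraph U).V // w' ≠ w},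
          ((G.restrict U hU).unrVertAbOf w'.1).map U.subtype) ⊔
        Subgroup.closure ((fun x : P => x ^ l) ''
          ((((G.restrict U hU).unrVertAbOf w).map U.subtype : Subgroup P) : Set P))).topologicalClosure := by
  have hset : ((U.subtype : U → P) '' ((fun a : U => a ^ l) '' ((G.restrict U hU).unrVertAbOf w : Set U))) =
      (fun x : P => x ^ l) ''
        ((((G.restrict U hU).unrVertAbOf w).map U.subtype : Subgroup P) : Set P) := by
    rw [Subgroup.coe_map, Set.image_image, Set.image_image]
    rfl
  unfold vertexQuotientKer
  rw [map_subtype_topologicalClosure_of_isOpen hU, Subgroup.map_sup, Subgroup.map_sup,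
    G.map_subtype_unrAbKer_restrict U hU hKU, Subgroup.map_iSup, MonoidHom.map_closure, hset]
  rfl

end Images

/-! ### 3. The action of `Π_G` on the vertices of `G_U` and the equivariance of `w ↦ M^unr_{G_U}[w]`, `w ↦ K_w` -/

section Action

variable {G U}

omit [TopologicalSpace P] [IsTopologicalGroup P] [U.FiniteIndex] in
/-- Conjugating the trace `U ∩ y Π_v y⁻¹` by `g` gives `U ∩ (g y) Π_v (g y)⁻¹` (`U` normal).
[cite: MochizukiCombGC2007, Def 1.1(ii) p.6] -/
theorem conj_inf_smul_eq (hUn : U.Normal) (g y : P) (V : Subgroup P) :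
    ConjAct.toConjAct g • (U ⊓ ConjAct.toConjAct y • V) = U ⊓ ConjAct.toConjAct (g * y) • V := by
  rw [Subgroup.smul_inf, hUn.conjAct, map_mul, mul_smul]

omit [TopologicalSpace P] [IsTopologicalGroup P] [U.FiniteIndex] in
/-- `y Π_v y⁻¹` only depends on the coset `y Π_v`. [cite: MochizukiCombGC2007, Def 1.1(ii) p.6] -/
private theorem smul_eq_of_mem {V : Subgroup P} {k : P} (hk : k ∈ V) (y : P) :
    ConjAct.toConjAct (y * k) • V = ConjAct.toConjAct y • V := by
  rw [map_mul, mul_smul]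
  congr 1
  ext b
  rw [Subgroup.mem_pointwise_smul_iff_inv_smul_mem, ← ConjAct.toConjAct_inv, ConjAct.smul_def,
    ConjAct.ofConjAct_toConjAct, inv_inv]
  constructor
  · intro hb
    have hb' := V.mul_mem (V.mul_mem hk hb) (V.inv_mem hk)
    rwa [show k * (k⁻¹ * b * k) * k⁻¹ = b by group] at hb'
  · exact fun hb => V.mul_mem (V.mul_mem (V.inv_mem hk) hb) hk

omit [IsTopologicalGroup P] in
/-- **The Galois action on the vertices of `G_U` and the verticial subgroups**: conjugation by
`g ∈ Π_G` carries `U ∩ y_w Π_v y_w⁻¹` to a `U`-conjugate of `U ∩ y_{g·w} Π_v y_{g·w}⁻¹`, where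
`g · w = (v, U g y_w Π_v)`. [cite: Mochizuki2012, IUTchI Rmk 1.2.3(iv) p.42] -/
theorem exists_conj_inf_smul_vertGp_eq (hUn : U.Normal) (g : P) (v : G.graph.V)
    (j : dcFin U (G.vertGp v)) :
    ∃ u ∈ U, ConjAct.toConjAct g • (U ⊓ ConjAct.toConjAct (G.vrep U ⟨v, j⟩) • G.vertGp v) =
      ConjAct.toConjAct u • (U ⊓ ConjAct.toConjAct
        (G.vrep U ⟨v, dcIdx U (G.vertGp v) (g * G.vrep U ⟨v, j⟩)⟩) • G.vertGp v) := by
  obtain ⟨u, hu, k, hk, hrep⟩ := exists_dcRep_dcIdx_eq U (G.vertGp v) (g * G.vrep U ⟨v, j⟩)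
  refine ⟨u⁻¹, U.inv_mem hu, ?_⟩
  rw [conj_inf_smul_eq hUn, conj_inf_smul_eq hUn]
  congr 1
  change ConjAct.toConjAct (g * G.vrep U ⟨v, j⟩) • G.vertGp v =
    ConjAct.toConjAct (u⁻¹ * dcRep U (G.vertGp v) (dcIdx U (G.vertGp v) (g * G.vrep U ⟨v, j⟩))) •
      G.vertGp v
  rw [hrep, show u⁻¹ * (u * (g * G.vrep U ⟨v, j⟩) * k) = g * G.vrep U ⟨v, j⟩ * k by group,
    smul_eq_of_mem hk]

omit [U.FiniteIndex] in
/-- `E^unr_{G_U} = closure([U,U]·Ker)` is normal in `Π_G` (`U` normal). [cite: Mochizuki2012, IUTchI Rmk 1.2.3(iv) p.42] -/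
theorem commutator_sup_unrKer_closure_normal (hUn : U.Normal) :
    ((⁅U, U⁆ ⊔ G.unrKer).topologicalClosure).Normal := by
  haveI : (⁅U, U⁆).Normal := Subgroup.commutator_normal U U
  haveI : (⁅U, U⁆ ⊔ G.unrKer).Normal := Subgroup.sup_normal _ _
  exact Subgroup.is_normal_topologicalClosure _

/-- **Equivariance of `w ↦ M^unr_{G_U}[w]`**: conjugation by `g ∈ Π_G` carries the inverse image of
`M^unr_{G_U}[w]` to that of `M^unr_{G_U}[g·w]` (conjugation by `U` acts trivially on `M^unr_{G_U}`).
[cite: Mochizuki2012, IUTchI Rmk 1.2.3(iv) p.42] -/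
theorem conj_map_unrVertAbOf_restrict (hUn : U.Normal) (hKU : G.unrKer ≤ U) (g : P) (v : G.graph.V)
    (j : dcFin U (G.vertGp v)) :
    ConjAct.toConjAct g • (((G.restrict U hU).unrVertAbOf ⟨v, j⟩).map U.subtype) =
      ((G.restrict U hU).unrVertAbOf ⟨v, dcIdx U (G.vertGp v) (g * G.vrep U ⟨v, j⟩)⟩).map U.subtype := by
  have hE : ConjAct.toConjAct g • (⁅U, U⁆ ⊔ G.unrKer).topologicalClosure =
      (⁅U, U⁆ ⊔ G.unrKer).topologicalClosure :=
    (G.commutator_sup_unrKer_closure_normal hUn).conjAct _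
  obtain ⟨u, hu, hconj⟩ := exists_conj_inf_smul_vertGp_eq (G := G) hUn g v j
  rw [G.map_subtype_unrVertAbOf_restrict U hU hKU, G.map_subtype_unrVertAbOf_restrict U hU hKU,
    conj_topologicalClosure, Subgroup.smul_sup, hE, hconj,
    conj_sup_eq_of_commutator_le hu inf_le_left (le_sup_left.trans (Subgroup.le_topologicalClosure _))]

omit [IsTopologicalGroup P] in
/-- Elements of `U` act trivially on the vertices of `G_U`: `u · w = w`. [cite: MochizukiCombGC2007, Def 1.1(ii) p.6] -/
theorem smulVertex_of_mem {u : P} (hu : u ∈ U) (v : G.graph.V) (j : dcFin U (G.vertGp v)) :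
    (⟨v, dcIdx U (G.vertGp v) (u * G.vrep U ⟨v, j⟩)⟩ : (G.restrictGraph U).V) = ⟨v, j⟩ := by
  rw [dcIdx_mul_vrep hu]

omit [IsTopologicalGroup P] in
/-- The action is associative: `g · (h · w) = (g h) · w` (`U` normal).
[cite: MochizukiCombGC2007, Def 1.1(ii) p.6] -/
theorem dcIdx_smulVertex (hUn : U.Normal) (g h : P) (v : G.graph.V) (j : dcFin U (G.vertGp v)) :
    dcIdx U (G.vertGp v) (g * G.vrep U ⟨v, dcIdx U (G.vertGp v) (h * G.vrep U ⟨v, j⟩)⟩) =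
      dcIdx U (G.vertGp v) (g * h * G.vrep U ⟨v, j⟩) := by
  obtain ⟨u, hu, k, hk, hrep⟩ := exists_dcRep_dcIdx_eq U (G.vertGp v) (h * G.vrep U ⟨v, j⟩)
  change dcIdx U (G.vertGp v) (g * dcRep U (G.vertGp v) (dcIdx U (G.vertGp v) (h * G.vrep U ⟨v, j⟩))) = _
  rw [hrep]
  refine (dcIdx_eq_iff U (G.vertGp v)).mpr ⟨g * u⁻¹ * g⁻¹, hUn.conj_mem _ (U.inv_mem hu) g, k⁻¹,
    (G.vertGp v).inv_mem hk, by group⟩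

omit [IsTopologicalGroup P] in
/-- `g · (g⁻¹ · w) = w`. [cite: MochizukiCombGC2007, Def 1.1(ii) p.6] -/
theorem dcIdx_smulVertex_inv (hUn : U.Normal) (g : P) (v : G.graph.V) (j : dcFin U (G.vertGp v)) :
    dcIdx U (G.vertGp v) (g * G.vrep U ⟨v, dcIdx U (G.vertGp v) (g⁻¹ * G.vrep U ⟨v, j⟩)⟩) = j := by
  rw [dcIdx_smulVertex hUn, mul_inv_cancel, dcIdx_mul_vrep U.one_mem]

omit [IsTopologicalGroup P] in
/-- `g⁻¹ · (g · w) = w`. [cite: MochizukiCombGC2007, Def 1.1(ii) p.6] -/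
theorem dcIdx_inv_smulVertex (hUn : U.Normal) (g : P) (v : G.graph.V) (j : dcFin U (G.vertGp v)) :
    dcIdx U (G.vertGp v) (g⁻¹ * G.vrep U ⟨v, dcIdx U (G.vertGp v) (g * G.vrep U ⟨v, j⟩)⟩) = j := by
  rw [dcIdx_smulVertex hUn, inv_mul_cancel, dcIdx_mul_vrep U.one_mem]

omit [IsTopologicalGroup P] in
/-- **The stabilizer of the vertex `w = U y Π_v` of `G_U` in `Π_G` is `U · y Π_v y⁻¹`.**
[cite: Mochizuki2012, IUTchI Rmk 1.2.3(iv) p.42] -/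
theorem dcIdx_mul_vrep_eq_iff (hUn : U.Normal) (g : P) (v : G.graph.V) (j : dcFin U (G.vertGp v)) :
    dcIdx U (G.vertGp v) (g * G.vrep U ⟨v, j⟩) = j ↔
      g ∈ U ⊔ ConjAct.toConjAct (G.vrep U ⟨v, j⟩) • G.vertGp v := by
  haveI := hUn
  set y := G.vrep U ⟨v, j⟩ with hy
  have hj : dcIdx U (G.vertGp v) y = j := by
    rw [← dcIdx_mul_vrep (G := G) U.one_mem v j, one_mul]
  conv_lhs => rw [← hj]
  rw [dcIdx_eq_iff, ← SetLike.mem_coe, Subgroup.normal_mul, Set.mem_mul]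
  constructor
  · rintro ⟨u, hu, k, hk, h⟩
    -- `y = u (g y) k` ⇒ `g = u⁻¹ · (y k⁻¹ y⁻¹)`
    refine ⟨u⁻¹, U.inv_mem hu, y * k⁻¹ * y⁻¹, ?_, ?_⟩
    · exact (Subgroup.mem_smul_pointwise_iff_exists _ _ _).mpr
        ⟨k⁻¹, (G.vertGp v).inv_mem hk, by rw [ConjAct.smul_def, ConjAct.ofConjAct_toConjAct]⟩
    · have e : u⁻¹ * y * k⁻¹ = g * y := by
        conv_lhs => rw [h]
        group
      calc u⁻¹ * (y * k⁻¹ * y⁻¹) = u⁻¹ * y * k⁻¹ * y⁻¹ := by group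
        _ = g * y * y⁻¹ := by rw [e]
        _ = g := by group
  · rintro ⟨u, hu, z, hz, rfl⟩
    obtain ⟨k, hk, rfl⟩ := (Subgroup.mem_smul_pointwise_iff_exists _ _ _).mp hz
    refine ⟨u⁻¹, U.inv_mem hu, k⁻¹, (G.vertGp v).inv_mem hk, ?_⟩
    rw [ConjAct.smul_def, ConjAct.ofConjAct_toConjAct]
    group

/-- **Equivariance of `w ↦ K_w` (functoriality of [IUTchI] Rmk. 1.2.3 (iv)'s characterization of the
vertices of `G_U`)**: conjugation by `g ∈ Π_G` carries the inverse image `K_w` of the kernel of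
`M^unr-vert_{G_U} ↠ M^unr_{G_U}[w] ⊗ F_l` to `K_{g·w}`. [cite: Mochizuki2012, IUTchI Rmk 1.2.3(iv) p.42] -/
theorem conj_map_vertexQuotientKer_restrict (hUn : U.Normal) (hKU : G.unrKer ≤ U) (l : ℕ) (g : P)
    (v : G.graph.V) (j : dcFin U (G.vertGp v)) :
    ConjAct.toConjAct g • (((G.restrict U hU).vertexQuotientKer l ⟨v, j⟩).map U.subtype) =
      ((G.restrict U hU).vertexQuotientKer l ⟨v, dcIdx U (G.vertGp v) (g * G.vrep U ⟨v, j⟩)⟩).map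
        U.subtype := by
  have hE : ConjAct.toConjAct g • (⁅U, U⁆ ⊔ G.unrKer).topologicalClosure =
      (⁅U, U⁆ ⊔ G.unrKer).topologicalClosure :=
    (G.commutator_sup_unrKer_closure_normal hUn).conjAct _
  rw [G.map_subtype_vertexQuotientKer_restrict U hU hKU, G.map_subtype_vertexQuotientKer_restrict U hU hKU,
    conj_topologicalClosure, Subgroup.smul_sup, Subgroup.smul_sup, hE, conj_iSup, conj_closure_pow_image,
    conj_map_unrVertAbOf_restrict hU hUn hKU g v j]
  congr 3
  -- the `⨆` over `w' ≠ w` is carried to the `⨆` over `w'' ≠ g · w`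
  refine le_antisymm (iSup_le ?_) (iSup_le ?_)
  · rintro ⟨⟨v', j'⟩, hw'⟩
    rw [conj_map_unrVertAbOf_restrict hU hUn hKU g v' j']
    refine le_iSup_of_le ⟨⟨v', dcIdx U (G.vertGp v') (g * G.vrep U ⟨v', j'⟩)⟩, fun h => hw' ?_⟩ le_rfl
    have h1 : v' = v := congrArg Sigma.fst h
    subst h1
    obtain ⟨-, h2⟩ := Sigma.mk.inj_iff.mp h
    have h2' := eq_of_heq h2
    have : j' = j := by
      rw [← dcIdx_inv_smulVertex (G := G) hUn g v' j', h2', dcIdx_inv_smulVertex hUn]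
    rw [this]
  · rintro ⟨⟨v'', j''⟩, hw''⟩
    have hne : (⟨v'', dcIdx U (G.vertGp v'') (g⁻¹ * G.vrep U ⟨v'', j''⟩)⟩ : (G.restrictGraph U).V) ≠
        ⟨v, j⟩ := by
      intro h
      apply hw''
      have h1 : v'' = v := congrArg Sigma.fst h
      subst h1
      obtain ⟨-, h2⟩ := Sigma.mk.inj_iff.mp h
      have h2' := eq_of_heq h2
      have : j'' = dcIdx U (G.vertGp v'') (g * G.vrep U ⟨v'', j⟩) := by
        rw [← dcIdx_smulVertex_inv (G := G) hUn g v'' j'', h2']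
      rw [this]
    refine le_iSup_of_le ⟨_, hne⟩ ?_
    change ((G.restrict U hU).unrVertAbOf ⟨v'', j''⟩).map U.subtype ≤
      ConjAct.toConjAct g • ((G.restrict U hU).unrVertAbOf
        ⟨v'', dcIdx U (G.vertGp v'') (g⁻¹ * G.vrep U ⟨v'', j''⟩)⟩).map U.subtype
    rw [conj_map_unrVertAbOf_restrict hU hUn hKU, dcIdx_smulVertex_inv hUn]

end Action


/-! ### 4. "By considering stabilizers of vertices": the stabilizer is the normalizer of `K_w` -/

section Stabilizer

variable {G U}

/-- **[IUTchI] Rmk. 1.2.3 (iv), "it suffices — by considering stabilizers of vertices of underlying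
semi-graphs of finite étale `Π^unr_G`-coverings of `G` — to give a functorial characterization of the
set of vertices"**: over abc-iut-L3-t4's covering datum `G_U` (`U` open normal, `U ⊇ Ker(Π_G ↠
Π^unr_G)`), granted that the vertices of `G_U` are characterized by their kernels
(`w ↦ K_w` injective: the first clause of abc-iut-w4-d052's typed `VertexSetCharacterization` applied
to `G_U`), the stabilizer `U · y Π_v y⁻¹` in `Π_G` of the vertex `w = U y Π_v` of `G_U` is the
NORMALIZER of `K_w ⊆ U ⊆ Π_G` — because `g K_w g⁻¹ = K_{g·w}` (`conj_map_vertexQuotientKer_restrict`).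
[cite: Mochizuki2012, IUTchI Rmk 1.2.3(iv) p.42] -/
theorem normalizer_map_vertexQuotientKer_restrict (hUn : U.Normal) (hKU : G.unrKer ≤ U) {l : ℕ}
    (hinj : Function.Injective ((G.restrict U hU).vertexQuotientKer l)) (v : G.graph.V)
    (j : dcFin U (G.vertGp v)) :
    Subgroup.normalizer ((((G.restrict U hU).vertexQuotientKer l ⟨v, j⟩).map U.subtype :
        Subgroup P) : Set P) = U ⊔ ConjAct.toConjAct (G.vrep U ⟨v, j⟩) • G.vertGp v := by
  ext g
  rw [← Subgroup.conjAct_pointwise_smul_iff, conj_map_vertexQuotientKer_restrict hU hUn hKU,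
    ← dcIdx_mul_vrep_eq_iff hUn]
  constructor
  · intro h
    have h' := hinj (Subgroup.map_injective U.subtype_injective h)
    obtain ⟨-, h2⟩ := Sigma.mk.inj_iff.mp h'
    exact eq_of_heq h2
  · intro h
    rw [h]

/-- The same with the injectivity supplied BY NAME through abc-iut-w4-d052's typed predicate
`VertexSetCharacterization` ([IUTchI] Rmk. 1.2.3 (iv) "the set of vertices … may be characterized as the
set of [nontrivial!] quotients") for the covering datum `G_U` (sturdy, `Σ = {l}`).
[cite: Mochizuki2012, IUTchI Rmk 1.2.3(iv) p.42] -/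
theorem normalizer_map_vertexQuotientKer_restrict_of_vertexSetCharacterization (hUn : U.Normal)
    (hKU : G.unrKer ≤ U) (hVS : (G.restrict U hU).VertexSetCharacterization)
    (hS : (G.restrict U hU).IsSturdy) {l : ℕ} (hl : G.Sigma = {l}) (v : G.graph.V)
    (j : dcFin U (G.vertGp v)) :
    Subgroup.normalizer ((((G.restrict U hU).vertexQuotientKer l ⟨v, j⟩).map U.subtype :
        Subgroup P) : Set P) = U ⊔ ConjAct.toConjAct (G.vrep U ⟨v, j⟩) • G.vertGp v :=
  normalizer_map_vertexQuotientKer_restrict hU hUn hKU (hVS hS l (by rw [restrict_Sigma, hl])).1 v j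

end Stabilizer

end PSCDatum

end Literature.AnabelianGeometry.SemiGraphs

end
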